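import Literature.NumberTheory.Transcendental.ZudilinSymmetry
import HarnessLib

/-!
# Zudilin's Lemma 19 at the parameters of Theorem 3: integrality of the coefficients

Topic `Literature/NumberTheory/Transcendental`. With the partial-fraction coefficients `B n s i`
of `Rₙ` (`ZudilinCoefficients.lean`), the linear form `Sₙ = ½ ∑_{k≥1} Rₙ''(k)` is
`∑_s qZeta n s · ζ(s+2) + qConst n` with the RATIONAL numbers

* `qZeta n s = C(s+1,2) ∑_i B n s i` (coefficient of `ζ(s+2)`; `A_{j-1}` of [Zudilin2004, (8.12)]),
* `qConst n = -∑_i ∑_s C(s+1,2) B n s i · H_i^{(s+2)}`, `H_i^{(m)} = ∑_{l=1}^{i} l^{-m}` (`-A₀`).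

This file proves the arithmetic half of **[Zudilin2004, Lemma 19]** for them:
`D_{35n}³ D_{34n} D_{33n}⁸ · Φₙ⁻¹ · qZeta n s ∈ ℤ` and `D_{35n}³ D_{34n} D_{33n}⁸ · Φₙ⁻¹ · qConst n ∈ ℤ`
(`Zudilin2004.qZeta_integral`, `Zudilin2004.qConst_integral`), prime by prime: for every prime
`p` the `p`-adic order of each term is `≥ 0` — for the primes of `Φ` (`√(91n+2) < p ≤ 33n`) by
(8.11) (`G_isDOrd`, `ν_{k',p} ≥ ν_p`, `ord_p D_M = 1`), for the other primes by (8.10)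
(`G_isDInt`) and `ord_p H_i^{(m)} ≥ -m ord_p D_i` with `i ≤ (36-s)n` (`B n s i = 0` otherwise).
Everything here is PROVED (no named facts).

## References

* [Zudilin2004] W. Zudilin, *Arithmetic of linear forms involving odd zeta values*, J. Théor.
  Nombres Bordeaux 16 (2004), 251–291, §8 Lemma 19 with (8.8)–(8.12).
* [Fischler2004] S. Fischler, Sém. Bourbaki exp. 910, Astérisque 294 (2004), §3.3
  (`2 d_{35n}³ d_{34n} d_{33n}⁸ Φₙ⁻¹ P_j(z) ∈ ℤ[z]`).
-/

noncomputable section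

open Finset Filter Literature.Analysis.Calculus
open scoped Nat

namespace Literature.NumberTheory.Transcendental

namespace Zudilin2004

/-! ### The rational coefficients of the linear form -/

/-- `H_i^{(m)} = ∑_{l=1}^{i} l^{-m}` (a rational number). [cite: Zudilin2004, §8 Lemma 19 (proof)] -/
def Hsum (i m : ℕ) : ℚ := ∑ l ∈ Icc 1 i, ((l : ℚ) ^ m)⁻¹

/-- The coefficient of `ζ(s+2)` in `Sₙ`: `C(s+1,2) ∑_{i} B n s i` (`A_{s+2}` of (8.12), with
`j - 1 = s + 2`, `r = 3`). [cite: Zudilin2004, §8 (8.12)] -/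
def qZeta (n s : ℕ) : ℚ := ((s + 1).choose 2 : ℚ) * ∑ i ∈ poleSet n, B n s i

/-- The constant term of `Sₙ`: `-∑_i ∑_s C(s+1,2) B n s i H_i^{(s+2)}` (`-A₀` of [Zudilin2004]).
[cite: Zudilin2004, §8 Lemma 19 (proof)] -/
def qConst (n : ℕ) : ℚ :=
  -∑ i ∈ poleSet n, ∑ s ∈ Icc 1 10, ((s + 1).choose 2 : ℚ) * B n s i * Hsum i (s + 2)

/-! ### Valuations of `D_M` and `Φ` -/

/-- `ord_p D_M = ⌊log_p M⌋`. [folklore] -/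
theorem padicValNat_lcmUpto (p M : ℕ) [hp : Fact p.Prime] :
    padicValNat p (Nat.lcmUpto M) = Nat.log p M := by
  rw [← Nat.factorization_def _ hp.out, Nat.factorization_lcmUpto M hp.out]

/-- `ord_p` of a product of prime powers over a set of primes. [folklore] -/
theorem padicValNat_prod_prime_pow {p : ℕ} [hp : Fact p.Prime] (S : Finset ℕ)
    (hS : ∀ q ∈ S, q.Prime) (e : ℕ → ℕ) :
    padicValNat p (∏ q ∈ S, q ^ e q) = if p ∈ S then e p else 0 := by
  classical
  induction S using Finset.induction_on with
  | empty => simp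
  | insert a S ha ih =>
    have haP : a.Prime := hS a (mem_insert_self a S)
    have hS' : ∀ q ∈ S, q.Prime := fun q hq => hS q (mem_insert_of_mem hq)
    rw [prod_insert ha, padicValNat.mul (pow_ne_zero _ haP.ne_zero)
      (prod_ne_zero_iff.2 fun q hq => pow_ne_zero _ (hS' q hq).ne_zero), ih hS',
      padicValNat.pow]
    by_cases hpa : p = a
    · subst hpa
      rw [padicValNat_self, if_pos (mem_insert_self p S), if_neg ha]; ring
    · haveI : Fact a.Prime := ⟨haP⟩
      rw [padicValNat_primes hpa, mul_zero, zero_add]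
      by_cases hpS : p ∈ S
      · rw [if_pos hpS, if_pos (mem_insert_of_mem hpS)]
      · rw [if_neg hpS, if_neg (by simp [hpa, hpS])]

/-- `ord_p Φₙ = ν_p` for the primes of `Φ`, `= 0` otherwise. [cite: Zudilin2004, §8 (8.8)] -/
theorem padicValNat_Phi (n p : ℕ) [hp : Fact p.Prime] :
    padicValNat p (Phi n) = if p ≤ 33 * n ∧ 91 * n + 2 < p ^ 2 then (nuMin n p).toNat else 0 := by
  unfold Phi
  rw [padicValNat_prod_prime_pow _ (fun q hq => (mem_filter.1 hq).2.1)]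
  have : (p ∈ (range (33 * n + 1)).filter fun q => q.Prime ∧ 91 * n + 2 < q ^ 2)
      ↔ (p ≤ 33 * n ∧ 91 * n + 2 < p ^ 2) := by
    simp only [mem_filter, mem_range]
    constructor
    · rintro ⟨h1, -, h2⟩; exact ⟨by omega, h2⟩
    · rintro ⟨h1, h2⟩; exact ⟨by omega, hp.out, h2⟩
  by_cases h : p ≤ 33 * n ∧ 91 * n + 2 < p ^ 2
  · rw [if_pos (this.2 h), if_pos h]
  · rw [if_neg (fun h' => h (this.1 h')), if_neg h]

/-! ### `p`-adic bounds for the pieces -/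

/-- `ord_p (1/N) = -ord_p N` for a natural `N ≠ 0`. [folklore] -/
theorem padicOrdGe_inv_natCast {p : ℕ} [Fact p.Prime] (N : ℕ) :
    PadicOrdGe p (-(padicValNat p N : ℤ)) ((N : ℚ))⁻¹ := by
  refine Or.inr (le_of_eq ?_)
  rw [padicValRat.inv, padicValRat.of_nat]

/-- (8.10) for the coefficients: `ord_p B n s i ≥ -(10-s) ord_p D_{33n}`. [cite: Zudilin2004, §8 (8.10)] -/
theorem padicOrdGe_B_of_isDInt {p : ℕ} [Fact p.Prime] (n : ℕ) {i : ℕ} (s : ℕ)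
    (hi : i ∈ poleSet n) :
    PadicOrdGe p (-((10 - s : ℕ) * (padicValNat p (Nat.lcmUpto (33 * n)) : ℤ))) (B n s i) := by
  obtain ⟨z, hz⟩ := (G_isDInt n hi 10).isInt (10 - s) (by omega)
  have hD : ((Nat.lcmUpto (33 * n)) : ℚ) ≠ 0 := by exact_mod_cast (Nat.lcmUpto_pos _).ne'
  have hB : B n s i = (z : ℚ) * ((((Nat.lcmUpto (33 * n)) : ℚ)) ^ (10 - s))⁻¹ := by
    rw [B, ← hz, mul_comm ((Nat.lcmUpto (33 * n) : ℚ) ^ (10 - s)) _, mul_assoc,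
      mul_inv_cancel₀ (pow_ne_zero _ hD), mul_one]
  rw [hB]
  have h1 : PadicOrdGe p 0 (z : ℚ) := PadicOrdGe.of_int z
  have h2 : PadicOrdGe p (-((10 - s : ℕ) * (padicValNat p (Nat.lcmUpto (33 * n)) : ℤ)))
      ((((Nat.lcmUpto (33 * n)) : ℚ) ^ (10 - s)))⁻¹ := by
    refine Or.inr (le_of_eq ?_)
    rw [padicValRat.inv, padicValRat.pow, padicValRat.of_nat]
  simpa using h1.mul h2

/-- (8.11) for the coefficients: for the primes `p` with `p² > 91n + 2`,
`ord_p B n s i ≥ ν_p - (10-s)` (`ν_{k',p} ≥ ν_p`, `k' = i + 27n + 1`). [cite: Zudilin2004, §8 (8.11)] -/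
theorem padicOrdGe_B_of_isDOrd {p : ℕ} [hp : Fact p.Prime] {n : ℕ} (hn : 1 ≤ n)
    (hp2 : 91 * n + 2 < p ^ 2) {i s : ℕ} (hi : i ∈ poleSet n) (hs : s ∈ Icc 1 10) :
    PadicOrdGe p (nuMin n p - (10 - s : ℕ)) (B n s i) := by
  have hs' := mem_Icc.1 hs
  have hi' := mem_Icc.1 hi
  have hp10 : 9 < p := by nlinarith [hp.out.two_le]
  have h := (G_isDOrd n hp2 hi 9).padicOrdGe_divDeriv hp10 (j := 10 - s) (by omega)
  refine h.mono ?_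
  have := nuMin_le (n := n) (p := p) (k := i + 27 * n + 1) (mem_Icc.2 ⟨by omega, by omega⟩)
  omega

/-- `ord_p H_i^{(m)} ≥ -m · ord_p D_i`. [cite: Zudilin2004, §8 Lemma 19 (proof)] -/
theorem padicOrdGe_Hsum {p : ℕ} [hp : Fact p.Prime] (i m : ℕ) :
    PadicOrdGe p (-((m * padicValNat p (Nat.lcmUpto i) : ℕ) : ℤ)) (Hsum i m) := by
  unfold Hsum
  refine PadicOrdGe.sum fun l hl => ?_
  have hl' := mem_Icc.1 hl
  have hl0 : (l : ℚ) ≠ 0 := by exact_mod_cast (show l ≠ 0 by omega)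
  have hle : padicValNat p l ≤ padicValNat p (Nat.lcmUpto i) := by
    have hdvd : l ∣ Nat.lcmUpto i := dvd_lcmUpto hl'.1 hl'.2
    exact (padicValNat_dvd_iff_le (Nat.lcmUpto_pos i).ne').1 (pow_padicValNat_dvd.trans hdvd)
  refine Or.inr ?_
  rw [padicValRat.inv, padicValRat.pow, padicValRat.of_nat]
  have : (m : ℤ) * padicValNat p l ≤ m * padicValNat p (Nat.lcmUpto i) := by
    exact_mod_cast Nat.mul_le_mul_left m hle
  simp only [Nat.cast_mul]
  linarith

/-! ### The term-by-term estimate -/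

/-- `ord_p D_M = 1` for `p ≤ M < p²`, `= 0` for `M < p`; monotone in `M`. [folklore] -/
theorem padicValNat_lcmUpto_eq_one {p M : ℕ} [hp : Fact p.Prime] (h1 : p ≤ M) (h2 : M < p ^ 2) :
    padicValNat p (Nat.lcmUpto M) = 1 := by
  rw [padicValNat_lcmUpto, Nat.log_eq_one_iff']
  exact ⟨h1, by nlinarith⟩

/-- Monotonicity of `ord_p D_M` in `M`. [folklore] -/
theorem padicValNat_lcmUpto_mono {p M M' : ℕ} [hp : Fact p.Prime] (h : M ≤ M') :
    padicValNat p (Nat.lcmUpto M) ≤ padicValNat p (Nat.lcmUpto M') := by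
  rw [padicValNat_lcmUpto, padicValNat_lcmUpto]
  exact Nat.log_mono_right h

/-- `ord_p D_M ≤ 1` for `M < p²`. [folklore] -/
theorem padicValNat_lcmUpto_le_one {p M : ℕ} [hp : Fact p.Prime] (h2 : M < p ^ 2) :
    padicValNat p (Nat.lcmUpto M) ≤ 1 := by
  rw [padicValNat_lcmUpto]
  rcases Nat.eq_zero_or_pos M with rfl | hM
  · simp
  · exact Nat.lt_succ_iff.1 ((Nat.log_lt_iff_lt_pow hp.out.one_lt hM.ne').2 h2)

/-- **The `p`-adic heart of Lemma 19**: for every prime `p`, `n ≥ 1`, `1 ≤ s ≤ 10`, `i ∈ [2n,35n]`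
and `m ≤ s+2` (`H = 1`, `m = 0`, or `H = H_i^{(s+2)}`, `m = s + 2`):
`ord_p (D_{35n}³ D_{34n} D_{33n}⁸ · B n s i · H · Φₙ⁻¹) ≥ 0`. [cite: Zudilin2004, §8 Lemma 19] -/
theorem padicOrdGe_term {p : ℕ} [hp : Fact p.Prime] {n : ℕ} (hn : 1 ≤ n) {i s : ℕ}
    (hi : i ∈ poleSet n) (hs : s ∈ Icc 1 10) {H : ℚ} {m : ℕ}
    (hH : PadicOrdGe p (-((m * padicValNat p (Nat.lcmUpto i) : ℕ) : ℤ)) H) (hm : m ≤ s + 2) :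
    PadicOrdGe p 0 ((D n : ℚ) * B n s i * H * ((Phi n : ℚ))⁻¹) := by
  have hs' := mem_Icc.1 hs
  have hi' := mem_Icc.1 hi
  -- the vanishing range
  by_cases hvan : (36 - s) * n < i
  · rw [B_eq_zero_of_lt n hs'.1 hs'.2 hvan]; simp [PadicOrdGe.zero]
  push Not at hvan
  -- valuation of `D`
  have hD : PadicOrdGe p ((3 * padicValNat p (Nat.lcmUpto (35 * n)) + padicValNat p (Nat.lcmUpto (34 * n))
      + 8 * padicValNat p (Nat.lcmUpto (33 * n)) : ℕ) : ℤ) (D n : ℚ) := by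
    refine Or.inr (le_of_eq ?_)
    have h33 : ((Nat.lcmUpto (33 * n) : ℕ) : ℚ) ≠ 0 := by exact_mod_cast (Nat.lcmUpto_pos _).ne'
    have h34 : ((Nat.lcmUpto (34 * n) : ℕ) : ℚ) ≠ 0 := by exact_mod_cast (Nat.lcmUpto_pos _).ne'
    have h35 : ((Nat.lcmUpto (35 * n) : ℕ) : ℚ) ≠ 0 := by exact_mod_cast (Nat.lcmUpto_pos _).ne'
    have hDq : ((D n : ℕ) : ℚ) = ((Nat.lcmUpto (35 * n) : ℕ) : ℚ) ^ 3 * ((Nat.lcmUpto (34 * n) : ℕ) : ℚ)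
        * ((Nat.lcmUpto (33 * n) : ℕ) : ℚ) ^ 8 := by
      unfold D; push_cast; ring
    rw [hDq, padicValRat.mul (mul_ne_zero (pow_ne_zero _ h35) h34) (pow_ne_zero _ h33),
      padicValRat.mul (pow_ne_zero _ h35) h34, padicValRat.pow, padicValRat.pow,
      padicValRat.of_nat, padicValRat.of_nat, padicValRat.of_nat]
    simp only [Nat.cast_add, Nat.cast_mul, Nat.cast_ofNat]
  -- valuation of `Φ⁻¹`
  have hΦ := padicOrdGe_inv_natCast (p := p) (Phi n)
  rw [padicValNat_Phi] at hΦ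
  -- weaken the exponent of `H` to a linear one
  have hmw : m * padicValNat p (Nat.lcmUpto i) ≤ (s + 2) * padicValNat p (Nat.lcmUpto i) :=
    Nat.mul_le_mul_right _ hm
  -- monotonicity facts
  have hvi35 : padicValNat p (Nat.lcmUpto i) ≤ padicValNat p (Nat.lcmUpto (35 * n)) :=
    padicValNat_lcmUpto_mono (by omega)
  have hvi34 : 2 ≤ s → padicValNat p (Nat.lcmUpto i) ≤ padicValNat p (Nat.lcmUpto (34 * n)) :=
    fun h2 => padicValNat_lcmUpto_mono (hvan.trans (Nat.mul_le_mul_right n (by omega)))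
  have hvi33 : 3 ≤ s → padicValNat p (Nat.lcmUpto i) ≤ padicValNat p (Nat.lcmUpto (33 * n)) :=
    fun h3 => padicValNat_lcmUpto_mono (hvan.trans (Nat.mul_le_mul_right n (by omega)))
  have h3334 : padicValNat p (Nat.lcmUpto (33 * n)) ≤ padicValNat p (Nat.lcmUpto (34 * n)) :=
    padicValNat_lcmUpto_mono (by omega)
  have h3435 : padicValNat p (Nat.lcmUpto (34 * n)) ≤ padicValNat p (Nat.lcmUpto (35 * n)) :=
    padicValNat_lcmUpto_mono (by omega)
  by_cases hΦp : p ≤ 33 * n ∧ 91 * n + 2 < p ^ 2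
  · -- a prime of `Φ`
    rw [if_pos hΦp] at hΦ
    have hB := padicOrdGe_B_of_isDOrd hn hΦp.2 hi hs
    have h1 : padicValNat p (Nat.lcmUpto (33 * n)) = 1 := padicValNat_lcmUpto_eq_one hΦp.1 (by nlinarith)
    have h2 : padicValNat p (Nat.lcmUpto (34 * n)) = 1 :=
      padicValNat_lcmUpto_eq_one (by omega) (by nlinarith)
    have h3 : padicValNat p (Nat.lcmUpto (35 * n)) = 1 :=
      padicValNat_lcmUpto_eq_one (by omega) (by nlinarith)
    have h4 : padicValNat p (Nat.lcmUpto i) ≤ 1 := padicValNat_lcmUpto_le_one (by nlinarith)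
    have hnn : 0 ≤ nuMin n p := nuMin_nonneg n p
    have hmv : m * padicValNat p (Nat.lcmUpto i) ≤ s + 2 :=
      (Nat.mul_le_mul hm h4).trans (by omega)
    have := ((hD.mul hB).mul hH).mul hΦ
    refine this.mono ?_
    rw [Int.toNat_of_nonneg hnn]
    generalize hw : m * padicValNat p (Nat.lcmUpto i) = w at hmv ⊢
    have hs2 := hs'.2
    omega
  · -- any other prime
    rw [if_neg hΦp] at hΦ
    have hB := padicOrdGe_B_of_isDInt (p := p) n s hi
    have := ((hD.mul hB).mul hH).mul hΦ
    refine this.mono ?_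
    generalize hw : m * padicValNat p (Nat.lcmUpto i) = w at hmw ⊢
    obtain ⟨hs1, hs2⟩ := hs'
    interval_cases s
    all_goals (norm_num at hmw ⊢; omega)

/-! ### Lemma 19: integrality -/

/-- **[Zudilin2004, Lemma 19] for the `ζ`-coefficients**: for `n ≥ 1` and `1 ≤ s ≤ 10`,
`D_{35n}³ D_{34n} D_{33n}⁸ · qZeta n s = Φₙ · (integer)`. [cite: Zudilin2004, §8 Lemma 19] -/
theorem qZeta_integral {n : ℕ} (hn : 1 ≤ n) {s : ℕ} (hs : s ∈ Icc 1 10) :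
    ∃ z : ℤ, (D n : ℚ) * qZeta n s = Phi n * z := by
  have hΦ0 : (Phi n : ℚ) ≠ 0 := by exact_mod_cast (Phi_pos n).ne'
  obtain ⟨z, hz⟩ := Rat.exists_int_of_padicOrdGe (q := (D n : ℚ) * qZeta n s * ((Phi n : ℚ))⁻¹)
    fun p hp => by
      haveI : Fact p.Prime := ⟨hp⟩
      unfold qZeta
      have e : (D n : ℚ) * (((s + 1).choose 2 : ℚ) * ∑ i ∈ poleSet n, B n s i) * ((Phi n : ℚ))⁻¹
          = ∑ i ∈ poleSet n, ((s + 1).choose 2 : ℚ) * ((D n : ℚ) * B n s i * 1 * ((Phi n : ℚ))⁻¹) := by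
        rw [mul_sum, mul_sum, sum_mul]
        exact sum_congr rfl fun i _ => by ring
      rw [e]
      refine PadicOrdGe.sum fun i hi => ?_
      have h := padicOrdGe_term (p := p) hn hi hs (H := 1) (m := 0)
        (by simpa using PadicOrdGe.of_int (p := p) 1) (by omega)
      simpa using (PadicOrdGe.of_nat (p := p) ((s + 1).choose 2)).mul h
  refine ⟨z, ?_⟩
  rw [← hz]
  field_simp

/-- **[Zudilin2004, Lemma 19] for the constant term**: for `n ≥ 1`,
`D_{35n}³ D_{34n} D_{33n}⁸ · qConst n = Φₙ · (integer)`. [cite: Zudilin2004, §8 Lemma 19] -/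
theorem qConst_integral {n : ℕ} (hn : 1 ≤ n) : ∃ z : ℤ, (D n : ℚ) * qConst n = Phi n * z := by
  have hΦ0 : (Phi n : ℚ) ≠ 0 := by exact_mod_cast (Phi_pos n).ne'
  obtain ⟨z, hz⟩ := Rat.exists_int_of_padicOrdGe (q := (D n : ℚ) * qConst n * ((Phi n : ℚ))⁻¹)
    fun p hp => by
      haveI : Fact p.Prime := ⟨hp⟩
      unfold qConst
      have e : (D n : ℚ) * (-∑ i ∈ poleSet n, ∑ s ∈ Icc 1 10,
            ((s + 1).choose 2 : ℚ) * B n s i * Hsum i (s + 2)) * ((Phi n : ℚ))⁻¹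
          = ∑ i ∈ poleSet n, ∑ s ∈ Icc 1 10, (-((s + 1).choose 2 : ℚ)) *
            ((D n : ℚ) * B n s i * Hsum i (s + 2) * ((Phi n : ℚ))⁻¹) := by
        rw [mul_neg, neg_mul, mul_sum, sum_mul, ← sum_neg_distrib]
        refine sum_congr rfl fun i _ => ?_
        rw [mul_sum, sum_mul, ← sum_neg_distrib]
        exact sum_congr rfl fun s _ => by ring
      rw [e]
      refine PadicOrdGe.sum fun i hi => PadicOrdGe.sum fun s hs => ?_
      have h := padicOrdGe_term (p := p) hn hi hs (H := Hsum i (s + 2)) (m := s + 2)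
        (padicOrdGe_Hsum i (s + 2)) le_rfl
      have hc : PadicOrdGe p 0 (-((s + 1).choose 2 : ℚ)) := by
        simpa using PadicOrdGe.of_int (p := p) (-((s + 1).choose 2 : ℤ))
      simpa using hc.mul h
  refine ⟨z, ?_⟩
  rw [← hz]
  field_simp

end Zudilin2004

end Literature.NumberTheory.Transcendental
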